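import Summits.QuantumAdvantage.QuantumAdvantage.Theses.SymplecticPurity
import Literature.Computability.MetaComplexity.RandReductionsLeak
import Literature.Computability.Cryptography.ClassBQPProofs
import Literature.Computability.Cryptography.QuantumCircuitProofs
import Literature.Computability.Cryptography.TCount

/-!
# `deq_thesis` (`FFThesis := BQP ⊆ BPP`): uniformity is load-bearing

Negative-side support file for the shared crux item `stmt-QuantumAdvantage-0242` (refuter
`cdisprove`). The crux `X := BQP ⊆ BPP` has no hypotheses; its content sits in the parameters of
`BQP`. Here: poly-time UNIFORMITY of the circuit family. Drop it (keep oracle-freeness, the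
`1/3`–`2/3` gap AND polynomial size) and the inclusion in `BPP` becomes FALSE:

* `BQPNonuniform` — `BQP` with `IsUniform` replaced by `IsPolySize` ("BQP/poly-style" families);
  `BQP_subset_BQPNonuniform` (uniform ⇒ poly-size, tree theorem `IsUniform.isPolySize'`), so
  `BQPNonuniform ⊆ BPP` is a strengthening of X;
* `lengthFamily χ` — an explicit witness family: one ancilla, at most three reversible operations
  compiled to Clifford+T (`revCompile`): clear wire `0` (`CNOT 0→n; CNOT n→0`), then write the
  non-uniform bit `χ n` on it; `lengthFamily_acceptProbOn`: it accepts `x` with probability EXACTLY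
  `[χ |x|]` (basis-state bookkeeping through the tree lemmas `revCompile_mulVec_basisState`,
  `acceptProb_of_runOn_eq_basisState`);
* `lengthSet_mem_BQPNonuniform` — so every length-language `{x | |x| ∈ S}` is in `BQPNonuniform`;
  `not_countable_BQPNonuniform` (Cantor) and
  **`deqThesis_false_without_uniformity : ¬ (BQPNonuniform ⊆ BPP)`** (`countable_BPP`).

Consequence for the dequantization routes: a classical simulator correct for ARBITRARY poly-size
Clifford+T families input-length by input-length (with no use of the uniform generator) cannot
exist; any proof of X must use `IsUniform`.

## References

* S. Arora, B. Barak, *Computational Complexity*, CUP 2009, §6.1 (non-uniform families decide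
  undecidable unary languages), §1.4 (countability of machine classes). [AroraBarakCC2009]
* A. C.-C. Yao, *Quantum circuit complexity*, FOCS 1993 (uniform quantum circuit families). [Yao1993]
-/

set_option linter.dupNamespace false -- D-0017: single-conjunct summit, namespace `Summit.QuantumAdvantage.QuantumAdvantage…` by design

open Computability
open Literature.Computability.Complexity Literature.Computability.Complexity.Classes
open Literature.Computability.Cryptography Literature.Computability.QuantumComplexity
open Literature.Computability.MetaComplexity

noncomputable section

namespace Summit.QuantumAdvantage.QuantumAdvantage.Theorems.DeqThesis.Negative

open Summit.QuantumAdvantage.QuantumAdvantage.Theses.SymplecticPurity (FFThesis)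

/-- `BQP` with poly-time UNIFORMITY dropped (polynomial SIZE kept): languages decided with error
`1/3` by some oracle-free, polynomial-size family of Clifford+T circuits, with no condition tying
the circuits of different input lengths together ("BQP/poly-style" non-uniform families).
[cite: AroraBarakCC2009, §6.1] -/
def BQPNonuniform : Set (Language Bool) :=
  {L | ∃ F : QCircuitFamily cliffordT, F.IsOracleFree ∧ F.IsPolySize ∧
    ∀ x, (x ∈ L → 2 / 3 ≤ F.acceptProbOn 0 x) ∧ (x ∉ L → F.acceptProbOn 0 x ≤ 1 / 3)}

/-- `BQP ⊆ BQPNonuniform` (uniform families are polynomial-size: tree theorem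
`IsUniform.isPolySize'`), so `BQPNonuniform ⊆ BPP` would imply the crux. [cite: Yao1993] -/
theorem BQP_subset_BQPNonuniform : BQP ⊆ BQPNonuniform := by
  intro L hL
  obtain ⟨F, hF, hU, h⟩ := ClassBQP.mem_BQP_iff.1 hL
  exact ⟨F, hF, hU.isPolySize', h⟩

/-- Reversible program on `n + 1` wires (inputs `0 … n-1`, one fresh ancilla `n`) that CLEARS
wire `0`: for `n = 0` nothing to do (wire `0` is the ancilla); for `n = k + 1`, `CNOT 0 → n`
copies `x₀` into the ancilla and `CNOT n → 0` cancels it. [folklore] -/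
def clearProg : (n : ℕ) → List (RevOp (n + 1))
  | 0 => []
  | k + 1 =>
    [RevOp.cnot ⟨0, by omega⟩ ⟨k + 1, by omega⟩ (Fin.ne_of_lt (Fin.mk_lt_mk.2 (Nat.succ_pos k))),
     RevOp.cnot ⟨k + 1, by omega⟩ ⟨0, by omega⟩ (Fin.ne_of_lt (Fin.mk_lt_mk.2 (Nat.succ_pos k))).symm]

/-- The flag program: `NOT` on wire `0` if the flag is set, nothing otherwise. [folklore] -/
def flagProg (b : Bool) (n : ℕ) : List (RevOp (n + 1)) :=
  if b then [RevOp.not ⟨0, Nat.succ_pos n⟩] else []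

/-- The NON-UNIFORM witness family of a bit sequence `χ : ℕ → Bool`: on inputs of length `n`,
clear wire `0` and write `χ n` on it (one ancilla, at most `3` reversible operations, compiled to
Clifford+T by `revCompile`). [folklore] -/
def lengthFamily (χ : ℕ → Bool) : QCircuitFamily cliffordT where
  ancillas _ := 1
  circ n := ⟨revCompile (clearProg n ++ flagProg (χ n) n)⟩

/-- The ancilla wire `n` of a padded input `x 0` is `0`. [folklore] -/
theorem padInput_one_last {n : ℕ} (x : QReg n) : padInput x 1 ⟨n, Nat.lt_succ_self n⟩ = false := by
  have : (⟨n, Nat.lt_succ_self n⟩ : Fin (n + 1)) = Fin.natAdd n (0 : Fin 1) := by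
    ext; simp
  rw [this, padInput, Fin.append_right]

/-- `clearProg` clears wire `0` of a padded input. [folklore] -/
theorem revEval_clearProg_zero (n : ℕ) (x : QReg n) :
    revEval (clearProg n) (padInput x 1) ⟨0, Nat.succ_pos n⟩ = false := by
  cases n with
  | zero => simpa [clearProg, revEval] using padInput_one_last x
  | succ k =>
    have hlast : padInput x 1 ⟨k + 1, by omega⟩ = false := padInput_one_last x
    simp [clearProg, revEval, RevOp.eval, Function.update_self, hlast]

/-- The witness program leaves the flag on wire `0`. [folklore] -/
theorem revEval_witness_zero (b : Bool) (n : ℕ) (x : QReg n) :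
    revEval (clearProg n ++ flagProg b n) (padInput x 1) ⟨0, Nat.succ_pos n⟩ = b := by
  rw [revEval_append]
  cases b with
  | false => simpa [flagProg, revEval] using revEval_clearProg_zero n x
  | true =>
    show revEval [RevOp.not ⟨0, Nat.succ_pos n⟩] (revEval (clearProg n) (padInput x 1))
      ⟨0, Nat.succ_pos n⟩ = true
    simp only [revEval, RevOp.eval, Function.update_self, revEval_clearProg_zero n x, Bool.not_false]

/-- The witness family is oracle-free. [folklore] -/
theorem lengthFamily_isOracleFree (χ : ℕ → Bool) : (lengthFamily χ).IsOracleFree :=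
  fun _ => revCompile_isOracleFree _

/-- The witness family has constant (hence polynomial) size: `≤ 72` gates, `1` ancilla. [folklore] -/
theorem lengthFamily_isPolySize (χ : ℕ → Bool) : (lengthFamily χ).IsPolySize := by
  refine ⟨Polynomial.C 72, fun n => ⟨?_, by simp [lengthFamily]⟩⟩
  have hops : (clearProg n ++ flagProg (χ n) n).length ≤ 3 := by
    rw [List.length_append]
    have h1 : (clearProg n).length ≤ 2 := by cases n <;> simp [clearProg]
    have h2 : (flagProg (χ n) n).length ≤ 1 := by unfold flagProg; split <;> simp
    omega
  show (revCompile (clearProg n ++ flagProg (χ n) n)).length ≤ (Polynomial.C 72).eval n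
  rw [Polynomial.eval_C]
  exact (length_revCompile_le _).trans (by omega)

/-- **Acceptance probability of the witness family**: exactly `[χ |x|]` (the compiled program maps
`|x⟩|0⟩` to a basis state with `χ |x|` on wire `0`). [folklore] -/
theorem lengthFamily_acceptProbOn (χ : ℕ → Bool) (x : List Bool) :
    (lengthFamily χ).acceptProbOn 0 x = if χ x.length then 1 else 0 := by
  show QCircuit.acceptProb 0 (⟨revCompile (clearProg x.length ++ flagProg (χ x.length) x.length)⟩ :
    QCircuit cliffordT (x.length + 1)) x.get = _
  rw [QCircuit.acceptProb_of_runOn_eq_basisState 0 _ x.get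
    (revEval (clearProg x.length ++ flagProg (χ x.length) x.length) (padInput x.get 1))
    (Nat.succ_pos _) (revCompile_mulVec_basisState 0 _ _), revEval_witness_zero]

/-- **Every length-language is decided exactly by a polynomial-size non-uniform family**:
`lengthSet S ∈ BQPNonuniform` for EVERY `S ⊆ ℕ` (witness `lengthFamily [· ∈ S]`).
[cite: AroraBarakCC2009, §6.1] -/
theorem lengthSet_mem_BQPNonuniform (S : Set ℕ) : lengthSet S ∈ BQPNonuniform := by
  refine ⟨lengthFamily S.boolIndicator, lengthFamily_isOracleFree _, lengthFamily_isPolySize _,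
    fun x => ⟨fun hx => ?_, fun hx => ?_⟩⟩
  · have hb : S.boolIndicator x.length = true := (Set.mem_iff_boolIndicator S x.length).1 hx
    rw [lengthFamily_acceptProbOn, hb]; norm_num
  · have hb : S.boolIndicator x.length = false := (Set.notMem_iff_boolIndicator S x.length).1 hx
    rw [lengthFamily_acceptProbOn, hb]; norm_num

/-- `BQPNonuniform` is UNCOUNTABLE (it contains the `2^ℵ₀` length-languages; Cantor).
[cite: AroraBarakCC2009, §1.4] -/
theorem not_countable_BQPNonuniform : ¬ BQPNonuniform.Countable := by
  intro hc
  have huniv : (Set.univ : Set (Set ℕ)).Countable :=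
    Set.MapsTo.countable_of_injOn (f := lengthSet) (fun S _ => lengthSet_mem_BQPNonuniform S)
      lengthSet_injective.injOn hc
  haveI : Countable (Set ℕ) := Set.countable_univ_iff.1 huniv
  obtain ⟨f, hf⟩ := exists_surjective_nat (Set ℕ)
  exact Function.cantor_surjective f hf

/-- **Uniformity is load-bearing for the crux**: `¬ (BQPNonuniform ⊆ BPP)` — `BPP` is countable
(tree theorem `countable_BPP`), `BQPNonuniform` is not. With `BQP_subset_BQPNonuniform` this refutes
a STRENGTHENING of `FFThesis`; any proof of `FFThesis` must use `IsUniform`. [folklore] -/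
theorem deqThesis_false_without_uniformity : ¬ (BQPNonuniform ⊆ BPP) :=
  fun h => not_countable_BQPNonuniform (countable_BPP.mono h)

/-- Packaged against the crux: the non-uniform inclusion would give `FFThesis`, and it is false.
[folklore] -/
theorem deqThesis_false_without_uniformity' :
    (BQPNonuniform ⊆ BPP → FFThesis) ∧ ¬ (BQPNonuniform ⊆ BPP) :=
  ⟨fun h _ hL => h (BQP_subset_BQPNonuniform hL), deqThesis_false_without_uniformity⟩


/-! #### Sharpening: the non-uniform witness is `T`-free and basis-preserving -/

/-- The witness programs use only `NOT` and `CNOT`: their compilations are `T`-FREE (pure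
Clifford words `H S S H`, `CNOT`). [folklore] -/
theorem tCount_lengthFamily (χ : ℕ → Bool) (n : ℕ) : ((lengthFamily χ).circ n).tCount = 0 := by
  show (⟨revCompile (clearProg n ++ flagProg (χ n) n)⟩ : QCircuit cliffordT (n + 1)).tCount = 0
  rw [QCircuit.tCount_eq_zero_iff]
  intro q hq e hqe
  subst hqe
  simp only [revCompile, List.mem_flatMap, List.mem_append] at hq
  obtain ⟨op, hop, hq⟩ := hq
  have hshape : (∃ i, op = RevOp.not i) ∨ ∃ i j h, op = RevOp.cnot i j h := by
    rcases hop with hop | hop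
    · cases n with
      | zero => simp [clearProg] at hop
      | succ k =>
        simp only [clearProg, List.mem_cons, List.not_mem_nil, or_false] at hop
        rcases hop with rfl | rfl
        · exact Or.inr ⟨_, _, _, rfl⟩
        · exact Or.inr ⟨_, _, _, rfl⟩
    · unfold flagProg at hop
      split at hop
      · simp only [List.mem_singleton] at hop
        exact Or.inl ⟨_, hop⟩
      · simp at hop
  rcases hshape with ⟨i, rfl⟩ | ⟨i, j, h, rfl⟩
  · simp [RevOp.compile, xWord, hOn, sOn] at hq
  · simp [RevOp.compile, cnotOn] at hq

/-- The witness circuits map every basis state to a basis state (classical reversible dynamics):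
all states along the family are computational-basis product states — bond dimension `1` at every
cut, stabilizer rank `1`, one nonzero Pauli-`Z`-diagonal expectation pattern. [folklore] -/
theorem lengthFamily_basis_to_basis (χ : ℕ → Bool) (n : ℕ) (w : QReg (n + 1)) :
    ∃ w' : QReg (n + 1), Matrix.mulVec (((lengthFamily χ).circ n).toMatrix 0) (basisState w) =
      basisState w' :=
  ⟨_, revCompile_mulVec_basisState 0 _ w⟩

/-- Some length-language lies OUTSIDE `BPP` (`2^ℵ₀` of them against the countable `BPP`; Cantor,
non-constructive). [cite: AroraBarakCC2009, §1.4] -/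
theorem exists_lengthSet_not_mem_BPP : ∃ S : Set ℕ, lengthSet S ∉ BPP := by
  by_contra h
  push Not at h
  have huniv : (Set.univ : Set (Set ℕ)).Countable :=
    Set.MapsTo.countable_of_injOn (f := lengthSet) (fun S _ => h S) lengthSet_injective.injOn
      countable_BPP
  haveI : Countable (Set ℕ) := Set.countable_univ_iff.1 huniv
  obtain ⟨f, hf⟩ := exists_surjective_nat (Set ℕ)
  exact Function.cantor_surjective f hf

/-- **STATE-COMPLEXITY ROADS NEED UNIFORMITY.** There is a language OUTSIDE `BPP` decided EXACTLY
(acceptance probability `1` on it, `0` off it) by an oracle-free, polynomial-size, `T`-FREE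
(`tCount = 0`, pure Clifford) family all of whose circuits map basis states to basis states. So no
hypothesis bounding the entanglement / magic / stabilizer rank / Pauli spectrum of the STATES of a
family — the currencies of the roads H_FF (SymplecticPurity), H_PP (PauliFlat), H_CL
(ShorLocallyDark), stabilizer-rank dequantization (Dequantize) — can by itself put the decided
language in `BPP`: every such road to X must also thread the UNIFORM GENERATOR of the family through
the classical simulation. [folklore] -/
theorem exists_tfree_basis_family_deciding_non_BPP :
    ∃ S : Set ℕ, lengthSet S ∉ BPP ∧ ∃ F : QCircuitFamily cliffordT,
      F.IsOracleFree ∧ F.IsPolySize ∧ (∀ n, (F.circ n).tCount = 0) ∧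
      (∀ (n : ℕ) (w : QReg (n + F.ancillas n)), ∃ w' : QReg (n + F.ancillas n),
        Matrix.mulVec ((F.circ n).toMatrix 0) (basisState w) = basisState w') ∧
      ∀ x, (x ∈ lengthSet S → F.acceptProbOn 0 x = 1) ∧ (x ∉ lengthSet S → F.acceptProbOn 0 x = 0) := by
  obtain ⟨S, hS⟩ := exists_lengthSet_not_mem_BPP
  refine ⟨S, hS, lengthFamily S.boolIndicator, lengthFamily_isOracleFree _, lengthFamily_isPolySize _,
    tCount_lengthFamily _, lengthFamily_basis_to_basis _, fun x => ⟨fun hx => ?_, fun hx => ?_⟩⟩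
  · have hb : S.boolIndicator x.length = true := (Set.mem_iff_boolIndicator S x.length).1 hx
    rw [lengthFamily_acceptProbOn, hb]; rfl
  · have hb : S.boolIndicator x.length = false := (Set.notMem_iff_boolIndicator S x.length).1 hx
    rw [lengthFamily_acceptProbOn, hb]; rfl

end Summit.QuantumAdvantage.QuantumAdvantage.Theorems.DeqThesis.Negative

end
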